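import Mathlib
import HarnessLib
import Literature.Computability.AlgebraicComplexity.ArithCircuit
import Literature.Computability.AlgebraicComplexity.ArithCircuitProofs
import Literature.Computability.AlgebraicComplexity.IMMInVPProofs
import Summits.ValiantsHypothesis.ValiantsHypothesis.Theses.MonotoneRestoration

/-! TTRL-lite variant V20238 of stmt-ValiantsHypothesis-15886 — converse link

# The probe `L(E_n) ≤ (n+2)²` sandwiched against `L(e_{⌊n/2⌋})`

Companion to `MonotoneRestorationMonotoneRestorationQPVariants20238.lean` (probe proved for
`n ≤ 11`, and `(linear bound on L(e_{⌊n/2⌋})) → probe`). Here the cheap CONVERSE link: killing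
all but the first column of the matrix of variables is a free substitution, so
`L(e_k(X_0, …, X_{n-1})) ≤ L(e_k(R_1, …, R_n))` over every commutative semiring
(`complexity_esymm_le_esymmRowSums`), whence the probe implies the quadratic bound
`L(e_{⌊n/2⌋}(X_0..X_{n-1})) ≤ (n + 2)²` over `ℝ≥0` (`esymm_quadratic_of_var20238`). Together with
the forward file: `5 n + 4`-linear ⟹ probe ⟹ `(n+2)²`-quadratic for the monotone complexity of
the middle elementary symmetric polynomial; the informal gate-elimination count sharpens the last
implication to `L(e_{⌊n/2⌋}) ≤ 5 n + 4`, which is why the probe is believed false from `n = 12`.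
-/

-- `Summit.ValiantsHypothesis.ValiantsHypothesis.…` is the tree's mandated single-conjunct layout
-- (Sub = Summit), so the duplicated namespace component is intended.
set_option linter.dupNamespace false

noncomputable section

namespace Summit.ValiantsHypothesis.ValiantsHypothesis.Theorems

open Summit.ValiantsHypothesis.ValiantsHypothesis.Theses.MonotoneRestoration
open Literature.Computability.AlgebraicComplexity
open MvPolynomial

/-- **Converse link.** `L(e_k(X_0, …, X_{n-1})) ≤ L(e_k(R_1, …, R_n))` over every commutative
semiring: substitute `x_{i0} ↦ X_i`, `x_{ij} ↦ 0` (`j ≠ 0`) — a free substitution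
(`complexity_aeval_le`, Bürgisser 2000, Rem. 2.7) mapping each row sum `R_i` to `X_i`.
[cite: Burgisser2000, Rem. 2.7] -/
theorem complexity_esymm_le_esymmRowSums {R : Type*} [CommSemiring R] (n k : ℕ) :
    complexity (MvPolynomial.esymm (Fin n) R k) ≤
      complexity (MvPolynomial.bind₁ (fun i : Fin n => ∑ j : Fin n, MvPolynomial.X (i, j))
        (MvPolynomial.esymm (Fin n) R k)) := by
  classical
  set g : Fin n × Fin n → MvPolynomial (Fin n) R :=
    fun p => if (p.2 : ℕ) = 0 then X p.1 else 0 with hg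
  have hrow : ∀ i : Fin n,
      aeval g (∑ j : Fin n, (X (i, j) : MvPolynomial (Fin n × Fin n) R)) = X i := by
    intro i
    have hn : 0 < n := Fin.pos i
    rw [map_sum]
    simp only [aeval_X, hg]
    rw [Finset.sum_eq_single (⟨0, hn⟩ : Fin n)]
    · simp
    · intro j _ hj
      have : (j : ℕ) ≠ 0 := fun h => hj (Fin.ext h)
      simp [this]
    · intro h
      exact absurd (Finset.mem_univ _) h
  have key : aeval g (MvPolynomial.bind₁ (fun i : Fin n => ∑ j : Fin n, MvPolynomial.X (i, j))
      (MvPolynomial.esymm (Fin n) R k)) = MvPolynomial.esymm (Fin n) R k := by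
    rw [aeval_bind₁]
    simp only [hrow]
    exact congrFun (congrArg DFunLike.coe (aeval_X_left (σ := Fin n) (R := R))) _
  have hcost : ∑ p : Fin n × Fin n, complexity (g p) = 0 := by
    refine Finset.sum_eq_zero fun p _ => ?_
    by_cases h : (p.2 : ℕ) = 0
    · simp only [hg, h, if_true]
      exact complexity_X_holds (k := R) _
    · simp only [hg, h, if_false]
      rw [← C_0]
      exact complexity_C_holds (σ := Fin n) (0 : R)
  calc complexity (MvPolynomial.esymm (Fin n) R k)
      = complexity (aeval g (MvPolynomial.bind₁
          (fun i : Fin n => ∑ j : Fin n, MvPolynomial.X (i, j))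
          (MvPolynomial.esymm (Fin n) R k))) := by rw [key]
    _ ≤ _ := complexity_aeval_le _ _
    _ = _ := by rw [hcost, add_zero]

/-- **Registered helper stub `stub_var20238_esymmLeRowSums`** (item stmt-ValiantsHypothesis-15886):
the converse link over `ℝ≥0`, `L(e_k(X_0, …, X_{n-1})) ≤ L(e_k(R_1, …, R_n))` for all `n, k`
(`complexity_esymm_le_esymmRowSums` at `R = ℝ≥0`). [cite: Burgisser2000, Rem. 2.7] -/
theorem stub_var20238_esymmLeRowSums : ∀ (n k : ℕ), complexity (MvPolynomial.esymm (Fin n) NNReal k) ≤ complexity (MvPolynomial.bind₁ (fun i : Fin n => ∑ j : Fin n, MvPolynomial.X (i, j)) (MvPolynomial.esymm (Fin n) NNReal k)) :=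
  fun n k => complexity_esymm_le_esymmRowSums n k

/-- **What the probe would give.** If `L(E_n) ≤ (n + 2)²` for all `n` (variant V20238), then the
middle elementary symmetric polynomial in `n` free variables has monotone complexity
`L(e_{⌊n/2⌋}(X_0, …, X_{n-1})) ≤ (n + 2)²` for all `n` (the informal gate-elimination count
sharpens this to `5 n + 4`). [folklore] -/
theorem esymm_quadratic_of_var20238
    (hS : ∀ n : ℕ, complexity (MvPolynomial.bind₁ (fun i : Fin n => ∑ j : Fin n,
      MvPolynomial.X (i, j)) (MvPolynomial.esymm (Fin n) NNReal (n / 2))) ≤ (n + 2) ^ 2) :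
    ∀ n : ℕ, complexity (MvPolynomial.esymm (Fin n) NNReal (n / 2)) ≤ (n + 2) ^ 2 :=
  fun n => (complexity_esymm_le_esymmRowSums n (n / 2)).trans (hS n)

end Summit.ValiantsHypothesis.ValiantsHypothesis.Theorems

end
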